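import Summits.Ventures.CertifiedManyBodySolver.Downfold.BoxesLa214V115M2bKinematicChord
import Summits.Ventures.CertifiedManyBodySolver.Downfold.BoxesLa214V115M2bCurtainTop
import HarnessLib

/-!
# Route CovLa214M2b — closers of the crux `SegmentFanCeiling` (stmt-Ventures-26183) from a SHORT inner family on `[−3/10, −13/50] × {29/5}`,
# and from the booked inner half-bundle `[−3/10, −1/4]` / full inner bundle `[−3/10, −1/5]` with the right vertex's condition RELAXED

Venture CertifiedManyBodySolver, route «CovLa214M2b» (Theses/CovLa214M2b.lean rev 0); seat `hubbard-cov-la214-unc-2` (`prover-hubbard-cov-la214-unc-2-0`,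
D-0154 (1)(C) COVERAGE, La214). COMPOSITION of two tree facts: (i) `SegmentFanCeiling_of_strip` (`Downfold/BoxesLa214V115M2bKinematicChord`, seat
hubbard-downfold-unc-2 g16: the certified free-fermion chord is under the bar on `t′ ∈ [−13/50, −1/5]`, so K1 lives on the strip `t′ ∈ [−3/10, −13/50]`, where
the segment condition forces the station source into `[−3/10, −13/50]` and `U ≤ 377/55`); (ii) the one-station leaf
`ObsStiffnessSeqCeilingAt_halfFilling_of_forall_apexStation_orbitLower` (`Observables/StiffnessApexTransport`). CONSEQUENCE FOR THE PRODUCER: K1 needs own words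
on the station segment `s ∈ [−3/10, −13/50]` ONLY (`Δs = 1/25`, not `1/10`): the booked half-bundle A `[−3/10, −1/4]` (vertices `(29/5; −3/10)` p610595 and the
`−1/4` twin, cov-la214-sdp-1 leg L2) suffices ALONE, and read on `[−3/10, −13/50]` its right-vertex condition relaxes to `−(1/5·vI₁ + 4/5·vI₂) ≤ 0.4364687`.

* `segmentFanCeiling_of_shortInnerFamily valI hI hcI` — own-word family on `[−3/10, −13/50] × {29/5}` priced `≤ 0.4364687` ⇒ `SegmentFanCeiling`;
* `segmentFanCeiling_of_innerHalfChordA vI₁ vI₂ …` — the chord of half-bundle A on `[−3/10, −1/4]` with `−vI₁ ≤ bar` and `−(vI₁/5 + 4vI₂/5) ≤ bar`;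
* `segmentFanCeiling_of_innerChord vI₁ vI₂ …` — the chord of the FULL inner bundle `[−3/10, −1/5]` (the `hInner` of
  `La214M2b_StiffnessBoxCeiling_of_apexStation29o5_twoBundles` verbatim) with `−vI₁ ≤ bar` and `−(3vI₁/5 + 2vI₂/5) ≤ bar`.

HONEST FRAMING: CONDITIONAL closers BY NAME (the item closes only when the named family/constants are certified by claim nodes); stiffness CEILINGS on a
downfolded box = CONTROL/CALIBRATION + labelled heuristic, silent on `ρ_s = 0`; no number of record, no certificate, no phase sentence; no summit statement
is proved by this seat.
-/

noncomputable section

namespace Summit.Ventures.CertifiedManyBodySolver.Theorems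

open Summit.Ventures.CertifiedManyBodySolver.Theses.CovLa214M2b
open Summit.Ventures.CertifiedManyBodySolver.Observables
open Summit.Ventures.CertifiedManyBodySolver.Downfold
open Literature.MathematicalPhysics.QuantumLattice Literature.MathematicalPhysics.QuantumLattice.ThermodynamicLimit
open Literature.Probability.LatticeModels
open Matrix Finset HubbardWave0
open scoped BigOperators ComplexOrder

/-- **An affine family on `[a, b]` read on a LEFT sub-segment `[a, m]` is at least the smaller of its values at `a` and at `m`.** `a < b`, `a ≤ s ≤ m`:
`min v₁ (chord m) ≤ chord s` with `chord s = (b − s)/(b − a)·v₁ + (s − a)/(b − a)·v₂` (`chord a = v₁`). [folklore] -/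
theorem chord_min_le_on_leftSubsegment {a b m s v₁ v₂ : ℝ} (hab : a < b) (has : a ≤ s) (hsm : s ≤ m) :
    min v₁ ((b - m) / (b - a) * v₁ + (m - a) / (b - a) * v₂) ≤ (b - s) / (b - a) * v₁ + (s - a) / (b - a) * v₂ := by
  have hd : 0 < b - a := sub_pos.2 hab
  have hne : b - a ≠ 0 := hd.ne'
  have e1 : (b - s) / (b - a) * v₁ + (s - a) / (b - a) * v₂ - v₁ = (s - a) / (b - a) * (v₂ - v₁) := by
    field_simp
    ring
  have e2 : (b - s) / (b - a) * v₁ + (s - a) / (b - a) * v₂ -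
      ((b - m) / (b - a) * v₁ + (m - a) / (b - a) * v₂) = (m - s) / (b - a) * (v₁ - v₂) := by
    field_simp
    ring
  rcases le_total v₁ v₂ with h | h
  · have h0 : 0 ≤ (s - a) / (b - a) * (v₂ - v₁) := mul_nonneg (div_nonneg (by linarith) hd.le) (by linarith)
    calc min v₁ ((b - m) / (b - a) * v₁ + (m - a) / (b - a) * v₂) ≤ v₁ := min_le_left _ _
      _ ≤ (b - s) / (b - a) * v₁ + (s - a) / (b - a) * v₂ := by linarith [e1]
  · have h0 : 0 ≤ (m - s) / (b - a) * (v₁ - v₂) := mul_nonneg (div_nonneg (by linarith) hd.le) (by linarith)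
    calc min v₁ ((b - m) / (b - a) * v₁ + (m - a) / (b - a) * v₂)
        ≤ (b - m) / (b - a) * v₁ + (m - a) / (b - a) * v₂ := min_le_right _ _
      _ ≤ (b - s) / (b - a) * v₁ + (s - a) / (b - a) * v₂ := by linarith [e2]

/-- **`SegmentFanCeiling` from a SHORT own-word family on `[−3/10, −13/50] × {29/5}`.** An unconditional orbit-lower family `valI` for the own `λ = 0`
f-sum word on the torus-limit ground-state classes at `(s, 29/5, 1)`, `s ∈ [−3/10, −13/50]`, priced `−valI s ≤ 0.4364687`, closes K1: on the strip
`t′ ∈ [−3/10, −13/50]` the station source `s = t′(2 − (29/5)/U)` lies in `[−3/10, t′] ⊆ [−3/10, −13/50]`, elsewhere the kinematic slab words the target.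
[cite: KomaTasaki1994, §1] [cite: ScalapinoWhiteZhang1993, §II] -/
theorem segmentFanCeiling_of_shortInnerFamily (valI : ℝ → ℝ)
    (hI : ∀ s ∈ Set.Icc (-3 / 10 : ℝ) (-13 / 50),
      ∀ (ω : InfVolFermionState 2) (Ls : ℕ → ℕ) (ψ : ∀ L, Fock (Orb (FermionTorus 2 L))),
      Filter.Tendsto Ls Filter.atTop Filter.atTop →
      (∀ j, IsGroundStateInSector (hubbardTorusTT' (Ls j) 1 s (29 / 5)) (rectN 1 (Ls j)) 0 (ψ (Ls j))) →
      (∀ j, star (ψ (Ls j)) ⬝ᵥ ψ (Ls j) = 1) → ω.IsTorusLimitOf ψ Ls →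
      valI s ≤ ((Finset.univ : Finset (DihedralGroup 4)).card : ℝ)⁻¹ * ∑ g ∈ (Finset.univ : Finset (DihedralGroup 4)),
        (ω.expect (d4ShiftSet g 0 (Literature.Probability.LatticeModels.box 2 7))
          (fermionEmbed (PolySite.d4Emb g 0 (Literature.Probability.LatticeModels.box 2 7)) (-oddMomentObsTT s (29 / 5) 0))).re)
    (hcI : ∀ s ∈ Set.Icc (-3 / 10 : ℝ) (-13 / 50), -valI s ≤ ((4364687 / 10000000 : ℚ) : ℝ)) :
    SegmentFanCeiling := by
  refine SegmentFanCeiling_of_strip fun tp htp U hU hs => ?_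
  have hUA : (0 : ℝ) < 29 / 5 := by norm_num
  have hUP : 0 < U := hUA.trans_le hU.1
  have e : tp * (2 - 29 / 5 / U) = tp * (2 * U - 29 / 5) / U := by field_simp
  rw [e] at hs
  have htp0 : tp ≤ 0 := htp.2.trans (by norm_num)
  have hsle : tp * (2 * U - 29 / 5) / U ≤ tp :=
    (apexSource_mem_Icc_of_slab (p := tp) (q := tp) (Umax := 74 / 5) hUA hU.1 hU.2 htp0 ⟨le_rfl, le_rfl⟩).2
  have hmem : tp * (2 * U - 29 / 5) / U ∈ Set.Icc (-3 / 10 : ℝ) (-13 / 50) := ⟨hs, hsle.trans htp.2⟩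
  exact ObsStiffnessSeqCeilingAt_halfFilling_of_forall_apexStation_orbitLower hUA.le valI (4364687 / 10000000) hI hcI hU.1 hUP hmem

/-- **`SegmentFanCeiling` from the INNER HALF-BUNDLE A `[−3/10, −1/4] × {29/5}` alone, right vertex RELAXED.** The chord of the own-word vertex constants `vI₁`
(at `−3/10`) and `vI₂` (at `−1/4`) on `[−3/10, −1/4]`, read only on `[−3/10, −13/50]`: conditions `−vI₁ ≤ 0.4364687` and `−(vI₁/5 + 4·vI₂/5) ≤ 0.4364687` (the
chord's value at `−13/50`) close K1 — half-bundle B `[−1/4, −1/5]` is not needed, and the `−1/4` vertex may exceed the bar by a quarter of the corner's margin.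
[cite: KomaTasaki1994, §1] [cite: ScalapinoWhiteZhang1993, §II] -/
theorem segmentFanCeiling_of_innerHalfChordA (vI₁ vI₂ : ℝ) (hcI₁ : -vI₁ ≤ ((4364687 / 10000000 : ℚ) : ℝ))
    (hcIm : -(1 / 5 * vI₁ + 4 / 5 * vI₂) ≤ ((4364687 / 10000000 : ℚ) : ℝ))
    (hInnerA : ∀ s ∈ Set.Icc (-3 / 10 : ℝ) (-1 / 4),
      ∀ (ω : InfVolFermionState 2) (Ls : ℕ → ℕ) (ψ : ∀ L, Fock (Orb (FermionTorus 2 L))),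
      Filter.Tendsto Ls Filter.atTop Filter.atTop →
      (∀ j, IsGroundStateInSector (hubbardTorusTT' (Ls j) 1 s (29 / 5)) (rectN 1 (Ls j)) 0 (ψ (Ls j))) →
      (∀ j, star (ψ (Ls j)) ⬝ᵥ ψ (Ls j) = 1) → ω.IsTorusLimitOf ψ Ls →
      (-1 / 4 - s) / (-1 / 4 - -3 / 10) * vI₁ + (s - -3 / 10) / (-1 / 4 - -3 / 10) * vI₂ ≤ ((Finset.univ : Finset (DihedralGroup 4)).card : ℝ)⁻¹ * ∑ g ∈ (Finset.univ : Finset (DihedralGroup 4)),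
        (ω.expect (d4ShiftSet g 0 (Literature.Probability.LatticeModels.box 2 7))
          (fermionEmbed (PolySite.d4Emb g 0 (Literature.Probability.LatticeModels.box 2 7)) (-oddMomentObsTT s (29 / 5) 0))).re) :
    SegmentFanCeiling := by
  refine segmentFanCeiling_of_shortInnerFamily
    (fun s => (-1 / 4 - s) / (-1 / 4 - -3 / 10) * vI₁ + (s - -3 / 10) / (-1 / 4 - -3 / 10) * vI₂)
    (fun s hs => hInnerA s ⟨hs.1, hs.2.trans (by norm_num)⟩) (fun s hs => ?_)
  have hmin := chord_min_le_on_leftSubsegment (a := -3 / 10) (b := -1 / 4) (m := -13 / 50) (v₁ := vI₁) (v₂ := vI₂) (by norm_num) hs.1 hs.2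
  have e : (-1 / 4 - -13 / 50 : ℝ) / (-1 / 4 - -3 / 10) * vI₁ + (-13 / 50 - -3 / 10) / (-1 / 4 - -3 / 10) * vI₂ = 1 / 5 * vI₁ + 4 / 5 * vI₂ := by
    norm_num
  rw [e] at hmin
  have hneg : -min vI₁ (1 / 5 * vI₁ + 4 / 5 * vI₂) ≤ ((4364687 / 10000000 : ℚ) : ℝ) := by
    rcases le_total vI₁ (1 / 5 * vI₁ + 4 / 5 * vI₂) with hv | hv
    · rw [min_eq_left hv]; exact hcI₁
    · rw [min_eq_right hv]; exact hcIm
  linarith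

/-- **`SegmentFanCeiling` from the FULL INNER BUNDLE `[−3/10, −1/5] × {29/5}`, right vertex RELAXED.** The chord of `vI₁` (at `−3/10`) and `vI₂` (at `−1/5`) —
the `hInner` hypothesis of `La214M2b_StiffnessBoxCeiling_of_apexStation29o5_twoBundles` verbatim — read only on `[−3/10, −13/50]`: conditions `−vI₁ ≤ 0.4364687` and
`−(3·vI₁/5 + 2·vI₂/5) ≤ 0.4364687` (the chord's value at `−13/50`) close K1. [cite: KomaTasaki1994, §1] [cite: ScalapinoWhiteZhang1993, §II] -/
theorem segmentFanCeiling_of_innerChord (vI₁ vI₂ : ℝ) (hcI₁ : -vI₁ ≤ ((4364687 / 10000000 : ℚ) : ℝ))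
    (hcIm : -(3 / 5 * vI₁ + 2 / 5 * vI₂) ≤ ((4364687 / 10000000 : ℚ) : ℝ))
    (hInner : ∀ s ∈ Set.Icc (-3 / 10 : ℝ) (-1 / 5),
      ∀ (ω : InfVolFermionState 2) (Ls : ℕ → ℕ) (ψ : ∀ L, Fock (Orb (FermionTorus 2 L))),
      Filter.Tendsto Ls Filter.atTop Filter.atTop →
      (∀ j, IsGroundStateInSector (hubbardTorusTT' (Ls j) 1 s (29 / 5)) (rectN 1 (Ls j)) 0 (ψ (Ls j))) →
      (∀ j, star (ψ (Ls j)) ⬝ᵥ ψ (Ls j) = 1) → ω.IsTorusLimitOf ψ Ls →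
      (-1 / 5 - s) / (-1 / 5 - -3 / 10) * vI₁ + (s - -3 / 10) / (-1 / 5 - -3 / 10) * vI₂ ≤ ((Finset.univ : Finset (DihedralGroup 4)).card : ℝ)⁻¹ * ∑ g ∈ (Finset.univ : Finset (DihedralGroup 4)),
        (ω.expect (d4ShiftSet g 0 (Literature.Probability.LatticeModels.box 2 7))
          (fermionEmbed (PolySite.d4Emb g 0 (Literature.Probability.LatticeModels.box 2 7)) (-oddMomentObsTT s (29 / 5) 0))).re) :
    SegmentFanCeiling := by
  refine segmentFanCeiling_of_shortInnerFamily
    (fun s => (-1 / 5 - s) / (-1 / 5 - -3 / 10) * vI₁ + (s - -3 / 10) / (-1 / 5 - -3 / 10) * vI₂)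
    (fun s hs => hInner s ⟨hs.1, hs.2.trans (by norm_num)⟩) (fun s hs => ?_)
  have hmin := chord_min_le_on_leftSubsegment (a := -3 / 10) (b := -1 / 5) (m := -13 / 50) (v₁ := vI₁) (v₂ := vI₂) (by norm_num) hs.1 hs.2
  have e : (-1 / 5 - -13 / 50 : ℝ) / (-1 / 5 - -3 / 10) * vI₁ + (-13 / 50 - -3 / 10) / (-1 / 5 - -3 / 10) * vI₂ = 3 / 5 * vI₁ + 2 / 5 * vI₂ := by
    norm_num
  rw [e] at hmin
  have hneg : -min vI₁ (3 / 5 * vI₁ + 2 / 5 * vI₂) ≤ ((4364687 / 10000000 : ℚ) : ℝ) := by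
    rcases le_total vI₁ (3 / 5 * vI₁ + 2 / 5 * vI₂) with hv | hv
    · rw [min_eq_left hv]; exact hcI₁
    · rw [min_eq_right hv]; exact hcIm
  linarith

end Summit.Ventures.CertifiedManyBodySolver.Theorems

end
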